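import Summits.QuantumFields.YangMills.Theorems.LuscherReductionTwistedTraceScalingBODefectRates
import Summits.QuantumFields.YangMills.Theorems.LuscherReductionTwistedTraceScalingBTRatesAtoms
import HarnessLib

/-!
# (C4-CORE γ-rates) AN ABSOLUTE PIECE `X ≤ e^{4β|E|}·Q·e^{−qℓ²}` OVER THE CURRENCY FLOOR `c_R β^{-K} e^{4β|E|}` IS `o(λ_bare)`; the schedule identity `β·r_F² = ℓ²`
# (lane A of S-BASE, crux `TwistedTraceScaling` stmt-QuantumFields-20203, C4-CORE, the (OD) pen; `pub/ym-fleet/ym-luscher-20007-p1/HANDOFF-g20.md` (γ))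

★ `piece_rate_small` — if eventually `X β ≤ ((e^{2β})^{|E|})²·Q β·e^{−qℓ²}` with `0 ≤ Q β ≤ P/(β^{-1})^m` and `q > 0`, then
`∀ a > 0, ∀ᶠ β, X β/(c_R·(β^{-1})^K·((e^{2β})^{|E|})²) ≤ a·bareLambda(L³β)` (`…BODefectRates.sq_rate_small_of_exp_btLog_sq`); this is the shape of the FP-tail, outer and
dual-BO-shell pieces over `…BOCurrencyFloor(Z).currency_floor(_inv)`.  ★ `eventually_beta_mul_rf_sq` — `β·r_F(β)² = ℓ²` eventually (`r_F = min(1/40, β^{-1/2}ℓ)`), turning the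
Gaussian factors `e^{−β·gap·(r_F/24)²}`, `e^{−β(r_F/1000)²}`, `e^{−β·gap·(r_F/12)²}` of the pieces into `e^{−cℓ²}`; `exp_neg_log_four_le` — `e^{−log⁴β/4} ≤ e^{−ℓ²/4}` eventually.
HONEST FRAMING: bookkeeping for a stub of a child of the CONDITIONAL route R2b1; the hOD assembly, (B-ST), C4-CORE remain OPEN; not a gap, not Clay.
-/

set_option autoImplicit false

noncomputable section

open Filter Topology Real
open Literature.MathematicalPhysics.QuantumFieldTheory
open Literature.MathematicalPhysics.QuantumLattice

namespace Summit.QuantumFields.YangMills.Theorems.FemtoTransferGap.TwoLattice.ConstTube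

open Summit.QuantumFields.YangMills.Theorems.FemtoTransferGap
open Summit.QuantumFields.YangMills.Theorems.FemtoTransferGap.TwoLattice

variable {L : ℕ} [NeZero L]

/-- ★ **A SUPER-POLYNOMIAL ABSOLUTE PIECE OVER THE CURRENCY FLOOR IS `o(λ_bare)`** (see the module docstring). [cite: Luscher1983, §3] -/
theorem piece_rate_small {X Q : ℝ → ℝ} {q P cR : ℝ} (hq : 0 < q) (hP : 0 ≤ P) (hcR : 0 < cR) (m K : ℕ)
    (hX : ∀ᶠ β : ℝ in atTop, X β ≤ (Real.exp (2 * β) ^ Fintype.card (Edge 3 L)) ^ 2 * Q β * Real.exp (-(q * btLog β ^ 2)))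
    (hQ : ∀ᶠ β : ℝ in atTop, 0 ≤ Q β ∧ Q β ≤ P / powScale 1 β ^ m) :
    ∀ a : ℝ, 0 < a → ∀ᶠ β : ℝ in atTop,
      X β / (cR * powScale 1 β ^ K * (Real.exp (2 * β) ^ Fintype.card (Edge 3 L)) ^ 2) ≤ a * bareLambda ((L : ℝ) ^ 3 * β) := by
  set F : ℝ → ℝ := fun β => cR * powScale 1 β ^ K * (Real.exp (2 * β) ^ Fintype.card (Edge 3 L)) ^ 2 with hF
  set b : ℝ → ℝ := fun β => Real.sqrt (max 0 (X β / F β)) with hb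
  -- `b² = max 0 (X/F) ≤ (P/c_R)·e^{−qℓ²}/ps1^{m+K}` eventually
  have hb2 : ∀ᶠ β : ℝ in atTop, b β ^ 2 ≤ P / cR * Real.exp (-(q * btLog β ^ 2)) / powScale 1 β ^ (m + K) := by
    filter_upwards [hX, hQ] with β hXβ ⟨hQ0, hQβ⟩
    have hps : 0 < powScale 1 β := powScale_pos 1 β
    set EK2 : ℝ := (Real.exp (2 * β) ^ Fintype.card (Edge 3 L)) ^ 2 with hEK2
    have hEK0 : 0 < EK2 := by positivity
    have hF0 : 0 < F β := by simp only [hF]; positivity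
    have hrhs0 : 0 ≤ P / cR * Real.exp (-(q * btLog β ^ 2)) / powScale 1 β ^ (m + K) := by positivity
    rw [hb, Real.sq_sqrt (le_max_left _ _), max_le_iff]
    refine ⟨hrhs0, ?_⟩
    rw [div_le_iff₀ hF0]
    calc X β ≤ EK2 * Q β * Real.exp (-(q * btLog β ^ 2)) := hXβ
      _ ≤ EK2 * (P / powScale 1 β ^ m) * Real.exp (-(q * btLog β ^ 2)) :=
          mul_le_mul_of_nonneg_right (mul_le_mul_of_nonneg_left hQβ hEK0.le) (Real.exp_pos _).le
      _ = P / cR * Real.exp (-(q * btLog β ^ 2)) / powScale 1 β ^ (m + K) * F β := by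
          simp only [hF, hEK2]; rw [pow_add]; field_simp
  have hsmall := sq_rate_small_of_exp_btLog_sq (L := L) hq (div_nonneg hP hcR.le) (m + K) (b := b)
    (by filter_upwards [hb2] with β h; rw [mul_div_assoc] at h ⊢; simpa [mul_div_assoc, div_div, mul_comm, mul_left_comm, mul_assoc] using h)
  intro a ha
  filter_upwards [hsmall a ha] with β hβ
  have h1 : X β / F β ≤ b β ^ 2 := by rw [hb, Real.sq_sqrt (le_max_left _ _)]; exact le_max_right _ _
  exact h1.trans hβ

omit [NeZero L] in
/-- ★ `β·r_F(β)² = ℓ²` eventually (`r_F = min(1/40, β^{-1/2}ℓ) = β^{-1/2}ℓ` eventually, `(β^{-1/2})²·β = 1` for `β ≥ 1`). [folklore] -/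
theorem eventually_beta_mul_rf_sq : ∀ᶠ β : ℝ in atTop, β * (min (1 / 40) (powScale (1 / 2) β * btLog β)) ^ 2 = btLog β ^ 2 := by
  have hr : Tendsto (fun β : ℝ => powScale (1 / 2) β * btLog β) atTop (𝓝 0) := by
    have h := tendsto_powScale_mul_btLog_pow (p := 1 / 2) (by norm_num) 1
    simpa only [pow_one] using h
  filter_upwards [hr.eventually (eventually_le_nhds (by norm_num : (0:ℝ) < 1 / 40)), eventually_ge_atTop (1 : ℝ)] with β h hβ1
  rw [min_eq_right h, mul_pow]
  have hps : powScale (1 / 2) β ^ 2 = β⁻¹ := by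
    rw [powScale_eq hβ1, ← Real.rpow_natCast, ← Real.rpow_mul (by linarith)]; norm_num
    exact Real.rpow_neg_one β
  rw [hps]; field_simp

omit [NeZero L] in
/-- `e^{−log⁴β/4} ≤ e^{−ℓ²/4}` eventually (`ℓ = log β ≥ 1`). [folklore] -/
theorem exp_neg_log_four_le : ∀ᶠ β : ℝ in atTop, Real.exp (-(Real.log β ^ 4 / 4)) ≤ Real.exp (-(1 / 4 * btLog β ^ 2)) := by
  filter_upwards [eventually_btLog_eq] with β hℓ
  rw [Real.exp_le_exp, neg_le_neg_iff, ← hℓ]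
  have h1 : 1 ≤ btLog β ^ 2 := one_le_pow₀ (one_le_btLog β)
  have h2 : btLog β ^ 4 = btLog β ^ 2 * btLog β ^ 2 := by ring
  nlinarith

end Summit.QuantumFields.YangMills.Theorems.FemtoTransferGap.TwoLattice.ConstTube

end
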